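import Summits.KontsevichZagierPeriods.KontsevichZagierPeriods.Theorems.MzvKernelInKZTwoPosetsDefs
import Summits.KontsevichZagierPeriods.KontsevichZagierPeriods.Theorems.MzvKernelInKZTwoPosetsShuffleProductAux
import Literature.NumberTheory.Transcendental.KZProductIdeal
import Literature.NumberTheory.Transcendental.KZSemiCanonicalReductionProofs

/-!
# `MzvKernelInKZ`, line two-posets-interior-landen: the shuffle product is a dissection

Stub `stub_shuffleProduct` of the crux `LinRedNormalForm.MzvKernelInKZ`
(stmt-KontsevichZagierPeriods-3914), line two-posets-interior-landen: the statement
`ShuffleProductInKZ` of `MzvKernelInKZTwoPosetsDefs.lean`.  For non-empty admissible words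
`ε` (length `a`) and `ε'` (length `b`) the product representation
`[Δ_a, ω_ε] · [Δ_b, ω_{ε'}] = [Δ_a × Δ_b, ω_ε ⊗ ω_{ε'}]` (`KZ.of_mul_of`,
`KZ.IntegralRep.prod_integrand_eq`) differs by relations from the sum, over all interleavings
`w ∈ ε ш ε'` (the tree's `MZV.shuffleWord`, with multiplicity), of the word representations
`[Δ_{a+b}, ω_w]`:

* the shuffle cells `{z | z ∘ e ∈ Δ_{a+b}}` of `Δ_a × Δ_b` (auxiliary file
  `MzvKernelInKZTwoPosetsShuffleProductAux.lean`: one for each sorting permutation `e` whose label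
  list `ofFn e` is a coordinate shuffle, i.e. lies in the `MZV.shuffleWord` of the two label lists
  `ofFn (castAdd b)`, `ofFn (natAdd a)`; pairwise disjoint, inside the product, covering it off
  the null tie walls `{xᵢ = yⱼ}`) give `[Δ_a × Δ_b, ω ⊗ ω'] ≡ Σ_cells` by iterated domain
  additivity (`KZ.of_sub_sum_of_mem_relations`, rule (1a));
* each cell carries the product integrand as the word integrand of the merged word
  `Fin.append ε ε' ∘ e` read along `e`, so it is the reindexing (`KZ.IntegralRep.reindex`, one
  coordinate permutation, rule (2): `KZ.of_sub_of_reindex_mem_relations`) of the word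
  representation of the merged word;
* the merged words, listed along the coordinate shuffles, are exactly
  `MZV.shuffleWord (ofFn ε) (ofFn ε')` with multiplicity (naturality `shuffleWord_map` of the
  recursion under the letters `Fin.append ε ε'`), so the cell classes sum to the stated list sum.

References: M. Kontsevich, D. Zagier, *Periods* (2001), §1.2; M. Eie, *The Theory of Multiple
Zeta Values with Applications in Combinatorics* (2013), §1.2; K. Ihara, M. Kaneko, D. Zagier,
Compos. Math. 142 (2006), §1 (finite double shuffle).
-/

noncomputable section

namespace Summit.KontsevichZagierPeriods.MzvKernelInKZ.TwoPosets

open Set MeasureTheory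
open Literature.NumberTheory.Transcendental
open Summit.KontsevichZagierPeriods.MzvKernelInKZ.Negative

/-! ## The dissection along a family of sorting permutations -/

section Dissection

variable {a b : ℕ} {ε : Fin a → Bool} {ε' : Fin b → Bool} (hε : Adm ε) (hε' : Adm ε')
  {ι : Type*} [Fintype ι] (e : ι → (Fin (a + b) ≃ Fin (a + b)))
  (hadm : ∀ i, Adm (fun k => Fin.append ε ε' (e i k)))

/-- Reading the relabelled label list of a permutation as a word of length `n`: the `k`-th
letter is the relabelled label of position `k`. [folklore] -/
theorem wordOf_map_ofFn {n : ℕ} (φ : Fin n → Bool) (f : Fin n → Fin n) :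
    wordOf n ((List.ofFn f).map φ) = fun k => φ (f k) := by
  funext k
  simp only [wordOf, List.map_ofFn, List.getD_eq_getElem?_getD, List.getElem?_ofFn, k.2,
    dif_pos, Option.getD_some, Function.comp_apply, Fin.eta]

/-- **The dissection** (rule (1a) iterated, then rule (2) once per cell).  If the permutations
`e i` enumerate the coordinate shuffles bijectively through `i ↦ ofFn (e i)`, the product
representation `[Δ_a × Δ_b, ω_ε ⊗ ω_{ε'}]` minus the sum of the word representations of the
merged words `Fin.append ε ε' ∘ e i` is a relation: the cells `{z | z ∘ e i ∈ Δ_{a+b}}` lie in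
`Δ_a × Δ_b`, carry its integrand, are pairwise disjoint and cover it off the null walls
`{xᵢ = yⱼ}` (`KZ.of_sub_sum_of_mem_relations`), and each cell is the word representation of its
merged word reindexed along `e i` (`KZ.of_sub_of_reindex_mem_relations`).
[cite: KontsevichZagier2001, §1.2] -/
theorem of_prod_sub_sum_of_wordRep_mem
    (hmem : ∀ i, List.ofFn (e i) ∈
      MZV.shuffleWord (List.ofFn (Fin.castAdd b : Fin a → Fin (a + b))) (List.ofFn (Fin.natAdd a)))
    (hinj : ∀ i j, List.ofFn (e i) = List.ofFn (e j) → i = j)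
    (hsurj : ∀ w ∈ MZV.shuffleWord (List.ofFn (Fin.castAdd b : Fin a → Fin (a + b)))
      (List.ofFn (Fin.natAdd a)), ∃ i, List.ofFn (e i) = w) :
    KZ.of ((wordRep ε 1 hε).prod (wordRep ε' 1 hε')) -
      ∑ i, KZ.of (wordRep _ 1 (hadm i)) ∈ KZ.relations := by
  -- rule (1a): the cells, as reindexed word representations, dissect the product
  have h1 : KZ.of ((wordRep ε 1 hε).prod (wordRep ε' 1 hε')) -
      ∑ i, KZ.of ((wordRep _ 1 (hadm i)).reindex (e i)) ∈ KZ.relations := by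
    refine KZ.of_sub_sum_of_mem_relations Finset.univ _
      (fun i => (wordRep _ 1 (hadm i)).reindex (e i)) (fun i _ => ?_) (fun i _ z _ => ?_)
      ?_ ?_
    · -- cells lie in the product
      rw [Set.sdiff_eq_empty.2 fun z hz => ?_, measure_empty]
      have hz' : (fun k => z (e i k)) ∈ simplex (a + b) := hz
      exact mem_simplex_of_comp_mem_simplex (hmem i) hz'
    · -- integrands agree
      simp only [KZ.IntegralRep.reindex_integrand, wordRep_integrand,
        KZ.IntegralRep.prod_integrand_eq, KZ.IntegralRep.prodFun_apply]
      exact wordFun_append_comp_equiv ε ε' (e i) z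
    · -- cover off the null walls
      refine measure_mono_null (fun z hz => ?_)
        (measure_iUnion_null_iff.2 fun i : Fin a => measure_iUnion_null_iff.2 fun j : Fin b =>
          volume_setOf_apply_eq_apply (n := a + b) (i := Fin.castAdd b i) (j := Fin.natAdd a j)
            fun h => absurd (congrArg Fin.val h) (by simp; omega))
      rw [Set.mem_sdiff, KZ.IntegralRep.prod_domain, KZ.IntegralRep.mem_prodDomain,
        wordRep_domain, wordRep_domain] at hz
      obtain ⟨⟨hx, hy⟩, hz⟩ := hz
      by_contra hne
      simp only [mem_iUnion, mem_setOf_eq, not_exists] at hne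
      obtain ⟨e₀, he₀, hz₀⟩ := exists_comp_mem_simplex hx hy hne
      obtain ⟨i, hi⟩ := hsurj _ he₀
      have hei : e i = e₀ := Equiv.ext (congrFun (List.ofFn_injective hi))
      refine hz (mem_iUnion₂.2 ⟨i, Finset.mem_univ _, ?_⟩)
      show (fun k => z (e i k)) ∈ simplex (a + b)
      rw [hei]
      exact hz₀
    · -- pairwise disjoint
      intro i _ j _ hij
      have he : ((wordRep _ 1 (hadm i)).reindex (e i)).domain ∩
          ((wordRep _ 1 (hadm j)).reindex (e j)).domain = ∅ := by
        refine eq_empty_of_forall_notMem fun z hz => hij (hinj i j ?_)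
        have hzi : (fun k => z (e i k)) ∈ simplex (a + b) := hz.1
        have hzj : (fun k => z (e j k)) ∈ simplex (a + b) := hz.2
        exact ofFn_eq_of_comp_mem_simplex hzi hzj
      rw [he, measure_empty]
  -- rule (2): each cell is a coordinate permutation of the word representation
  have h2 : ∑ i,
      (KZ.of (wordRep _ 1 (hadm i)) - KZ.of ((wordRep _ 1 (hadm i)).reindex (e i))) ∈
        KZ.relations :=
    sum_mem fun i _ => KZ.of_sub_of_reindex_mem_relations _ _
  rw [Finset.sum_sub_distrib] at h2
  convert KZ.relations.sub_mem h1 h2 using 1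
  abel

/-- **The merged words are the shuffles**: along a bijective enumeration of the coordinate
shuffles, the sum of the classes of the merged word representations is the sum of
`[Δ_{a+b}, ω_w]` over `w ∈ MZV.shuffleWord (ofFn ε) (ofFn ε')` with multiplicity (naturality of
`ш` under the letters `Fin.append ε ε'`; every merged word is admissible).
[cite: Eie2013, §1.2] -/
theorem sum_of_wordRep_eq
    (hmem : ∀ i, List.ofFn (e i) ∈
      MZV.shuffleWord (List.ofFn (Fin.castAdd b : Fin a → Fin (a + b))) (List.ofFn (Fin.natAdd a)))
    (hinj : ∀ i j, List.ofFn (e i) = List.ofFn (e j) → i = j)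
    (hsurj : ∀ w ∈ MZV.shuffleWord (List.ofFn (Fin.castAdd b : Fin a → Fin (a + b)))
      (List.ofFn (Fin.natAdd a)), ∃ i, List.ofFn (e i) = w) :
    ∑ i, KZ.of (wordRep _ 1 (hadm i)) =
      ((MZV.shuffleWord (List.ofFn ε) (List.ofFn ε')).map
        fun w => zWord (a + b) (wordOf (a + b) w) 1).sum := by
  classical
  have hl : List.ofFn ε =
      (List.ofFn (Fin.castAdd b : Fin a → Fin (a + b))).map (Fin.append ε ε') := by
    rw [List.map_ofFn]
    exact congrArg List.ofFn (funext fun i => by simp)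
  have hr : List.ofFn ε' =
      (List.ofFn (Fin.natAdd a : Fin b → Fin (a + b))).map (Fin.append ε ε') := by
    rw [List.map_ofFn]
    exact congrArg List.ofFn (funext fun j => by simp)
  have hnd : (MZV.shuffleWord (List.ofFn (Fin.castAdd b : Fin a → Fin (a + b)))
      (List.ofFn (Fin.natAdd a))).Nodup :=
    nodup_shuffleWord _ _
      (by rw [ofFn_castAdd_append_ofFn_natAdd]; exact List.nodup_finRange _)
  rw [hl, hr, shuffleWord_map, List.map_map, ← List.sum_toFinset _ hnd]
  refine Finset.sum_bij (fun i _ => List.ofFn (e i)) (fun i _ => List.mem_toFinset.2 (hmem i))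
    (fun i _ j _ h => hinj i j h) (fun w hw => ?_) (fun i _ => ?_)
  · obtain ⟨i, hi⟩ := hsurj w (List.mem_toFinset.1 hw)
    exact ⟨i, Finset.mem_univ _, hi⟩
  · rw [Function.comp_apply, wordOf_map_ofFn, zWord, dif_pos (hadm i)]

end Dissection

/-- **The shuffle product is a dissection** (stub `stub_shuffleProduct` of the line
two-posets-interior-landen): for non-empty admissible words `ε`, `ε'`,
`[Δ_a, ω_ε] · [Δ_b, ω_{ε'}] − Σ_{w ∈ ε ш ε'} [Δ_{a+b}, ω_w] ∈ KZ.relations` — the shuffle cells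
dissect `Δ_a × Δ_b` up to the null tie walls (rule (1a)) and each cell is a coordinate
permutation (rule (2)) of a word representation. [cite: KontsevichZagier2001, §1.2] -/
theorem stub_shuffleProduct : ShuffleProductInKZ := by
  intro a b ε ε' hε hε' ha hb
  obtain ⟨N, e, hmem, hinj, hsurj⟩ := exists_enum_coordShuffles a b
  have hadm : ∀ i, Adm (fun k => Fin.append ε ε' (e i k)) := fun i =>
    adm_append_comp_equiv hε hε' ha hb (hmem i)
  rw [KZ.of_mul_of, ← sum_of_wordRep_eq e hadm hmem hinj hsurj]
  exact of_prod_sub_sum_of_wordRep_mem hε hε' e hadm hmem hinj hsurj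

end Summit.KontsevichZagierPeriods.MzvKernelInKZ.TwoPosets
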